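import Summits.CriticalPhenomena.PercolationContinuityZ3.Theorems.PercNearOneGluingNoHeavyLowerTailPortSelection
import HarnessLib

/-!
# `NoHeavyLowerTail` (stmt-CriticalPhenomena-4575) — the TWO-UNIT SPLIT of the port-selection target
# (`noHeavyLowerTail_of_splitSelection`)

Lemma factory #6 (`prim-lf-6`, gen 6), 2026-08-19; candidates B6.3 (S1, S2) of
`run/shared/lean/prim/prim-lf-6/CANDIDATES.md`.  The port-selection bound
`SteinerBlob.lowerTail_le_sum_selection` charges, per blob `V₀ ∋ o`, the event
`{N_o ≥ 1} ∩ {c(V₀) light} ∩ Blob(V₀)`.  Splitting on whether the selected relay `c(V₀)` lies in `o`'s cluster gives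
the two units of the conjectured constant `2 = 1 + 1`:
* on `{o ↔ c(V₀)}` the selected relay is light iff `o`'s cluster is light, so that part is the bad event WITH the selected
  port inside `o`'s cluster (candidate S1: `≤ 1 · max_a μ(|π(a)| ≤ j)`, a restricted cumulative-isolation statement);
* on `{o ↮ c(V₀)}` the part is "selected port detached from `o` and light while `o` is attached" (candidate S2: the pure
  selection-bias statement, `≤ 1 · max_a μ(|π(a)| ≤ j)`).
`noHeavyLowerTail_of_splitSelection (C₁ C₂)`: bounds of the two parts with k-uniform constants close the crux (through
`noHeavyLowerTail_of_portSelection (C₁ + C₂)`).  Census: both parts → 1⁻ simultaneously on the stacking extremiser, 0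
violations in ≈ 2·10⁴ exact asymptotic cases and on the width-axis families (CANDIDATES §B6.1–B6.6); ttrl2 request
`lf6-S1S2-two-units`.  No definitions, no sorries.
-/

namespace Summit.CriticalPhenomena.PercolationContinuityZ3.Theorems

open MeasureTheory Set Literature.Probability.LatticeModels Literature.Probability.Percolation
open scoped Classical BigOperators

namespace SteinerBlob

variable {n : ℕ}

/-- Two vertices in the same open cluster see the same relays: if `o ↔ c` then
`{x ∈ A | c ↔ x} = {x ∈ A | o ↔ x}`. [folklore] -/
theorem filter_openConn_eq_of_mem_openConn (A : Finset (Fin n)) {o c : Fin n} {ω : BondConfig (Fin n)}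
    (h : ω ∈ openConn o c) :
    (A.filter fun x => ω ∈ openConn c x) = (A.filter fun x => ω ∈ openConn o x) := by
  apply Finset.filter_congr
  intro x _
  change (openGraph ω).Reachable c x ↔ (openGraph ω).Reachable o x
  have h' : (openGraph ω).Reachable o c := h
  exact ⟨fun hx => h'.trans hx, fun hx => h'.symm.trans hx⟩

/-- **Per-blob two-unit split.**  For every relay `c` and blob `V₀`:
`μ({N_o ≥ 1} ∩ {|π(c)| ≤ j} ∩ Blob) ≤ μ({o ↔ c} ∩ {|π(o)| ≤ j} ∩ Blob) + μ({N_o ≥ 1} ∩ {o ↮ c} ∩ {|π(c)| ≤ j} ∩ Blob)`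
(on `{o ↔ c}` the clusters of `o` and `c` carry the same relays). [this work] -/
theorem selectionSummand_le_split (μ : Measure (BondConfig (Fin n))) [IsFiniteMeasure μ] (A V₀ : Finset (Fin n))
    (o c : Fin n) (j : ℕ) :
    μ.real ({ω : BondConfig (Fin n) | 1 ≤ (A.filter fun x => ω ∈ openConn o x).card} ∩
        {ω : BondConfig (Fin n) | (A.filter fun x => ω ∈ openConn c x).card ≤ j} ∩
        {ω : BondConfig (Fin n) | (∀ u ∈ V₀, ω ∈ openConnIn (↑V₀ : Set (Fin n)) o u) ∧
          ∀ u ∈ V₀, ∀ x, x ∉ V₀ → x ∉ A → s(u, x) ∉ ω}) ≤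
      μ.real (openConn o c ∩ {ω : BondConfig (Fin n) | (A.filter fun x => ω ∈ openConn o x).card ≤ j} ∩
        {ω : BondConfig (Fin n) | (∀ u ∈ V₀, ω ∈ openConnIn (↑V₀ : Set (Fin n)) o u) ∧
          ∀ u ∈ V₀, ∀ x, x ∉ V₀ → x ∉ A → s(u, x) ∉ ω}) +
      μ.real ({ω : BondConfig (Fin n) | 1 ≤ (A.filter fun x => ω ∈ openConn o x).card} ∩ (openConn o c)ᶜ ∩
        {ω : BondConfig (Fin n) | (A.filter fun x => ω ∈ openConn c x).card ≤ j} ∩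
        {ω : BondConfig (Fin n) | (∀ u ∈ V₀, ω ∈ openConnIn (↑V₀ : Set (Fin n)) o u) ∧
          ∀ u ∈ V₀, ∀ x, x ∉ V₀ → x ∉ A → s(u, x) ∉ ω}) := by
  refine (measureReal_mono ?_ (measure_ne_top _ _)).trans (measureReal_union_le _ _)
  intro ω hω
  obtain ⟨⟨hN, hc⟩, hB⟩ := hω
  by_cases hoc : ω ∈ openConn o c
  · left
    refine ⟨⟨hoc, ?_⟩, hB⟩
    have hc' : (A.filter fun x => ω ∈ openConn c x).card ≤ j := hc
    show (A.filter fun x => ω ∈ openConn o x).card ≤ j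
    rwa [filter_openConn_eq_of_mem_openConn A hoc] at hc'
  · right
    exact ⟨⟨⟨hN, hoc⟩, hc⟩, hB⟩

end SteinerBlob

open SteinerBlob in
/-- **The two-unit split closes the crux** (lemma factory #6, candidates S1/S2, typed).  Suppose that for some constants
`C₁, C₂ ≥ 0`, on every finite weighted graph, for every nonempty relay set `A`, observer `o ∉ A` and level `j` there are a
selection `c` — assigning to every blob `V₀ ∋ o` disjoint from `A` a relay at least as fragile AVOIDING `V₀` as every relay
adjacent to the blob — and a relay `a ∈ A` such that
(S1) `Σ_{V₀} μ(o ↔ c(V₀) ∧ |π(o)| ≤ j ∧ Blob(V₀)) ≤ C₁ · μ(|π(a)| ≤ j)` (the lower-tail event with the selected port INSIDE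
`o`'s cluster) and
(S2) `Σ_{V₀} μ(N_o ≥ 1 ∧ o ↮ c(V₀) ∧ |π(c(V₀))| ≤ j ∧ Blob(V₀)) ≤ C₂ · μ(|π(a)| ≤ j)` (the selected port DETACHED from `o`
and light while `o` is attached).  Then `NoHeavyLowerTail` holds (via `noHeavyLowerTail_of_portSelection (C₁ + C₂)` and the
per-blob split `selectionSummand_le_split`).  Conjecture (CANDIDATES §B6.3): `C₁ = C₂ = 1`, both sharp on the stacking
extremiser. [this work] -/
theorem noHeavyLowerTail_of_splitSelection (C₁ C₂ : ℝ) (hC₁ : 0 ≤ C₁) (hC₂ : 0 ≤ C₂)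
    (hSPLIT : ∀ (n : ℕ) (w : Sym2 (Fin n) → unitInterval) (A : Finset (Fin n)) (o : Fin n) (j : ℕ),
      A.Nonempty → o ∉ A → ∃ c : Finset (Fin n) → Fin n,
        (∀ V₀ : Finset (Fin n), o ∈ V₀ → Disjoint V₀ A → c V₀ ∈ A ∧
          ∀ v ∈ A, (∃ u ∈ V₀, w s(u, v) ≠ 0) →
            (Literature.Probability.LatticeModels.prodBernoulli w).real
                {ω : Literature.Probability.Percolation.BondConfig (Fin n) |
                  (A.filter fun z => ω ∈ Literature.Probability.Percolation.openConnIn ((↑V₀ : Set (Fin n))ᶜ) v z).card ≤ j} ≤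
              (Literature.Probability.LatticeModels.prodBernoulli w).real
                {ω : Literature.Probability.Percolation.BondConfig (Fin n) |
                  (A.filter fun z => ω ∈ Literature.Probability.Percolation.openConnIn ((↑V₀ : Set (Fin n))ᶜ) (c V₀) z).card ≤ j}) ∧
        ∃ a ∈ A,
          (∑ V₀ ∈ (Finset.univ : Finset (Finset (Fin n))).filter (fun V₀ => o ∈ V₀ ∧ Disjoint V₀ A),
              (Literature.Probability.LatticeModels.prodBernoulli w).real
                (Literature.Probability.Percolation.openConn o (c V₀) ∩
                  {ω : Literature.Probability.Percolation.BondConfig (Fin n) |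
                    (A.filter fun x => ω ∈ Literature.Probability.Percolation.openConn o x).card ≤ j} ∩
                  {ω : Literature.Probability.Percolation.BondConfig (Fin n) |
                    (∀ u ∈ V₀, ω ∈ Literature.Probability.Percolation.openConnIn (↑V₀ : Set (Fin n)) o u) ∧
                      ∀ u ∈ V₀, ∀ x, x ∉ V₀ → x ∉ A → s(u, x) ∉ ω}) ≤
            C₁ * (Literature.Probability.LatticeModels.prodBernoulli w).real
                {ω : Literature.Probability.Percolation.BondConfig (Fin n) |
                  (A.filter fun x => ω ∈ Literature.Probability.Percolation.openConn a x).card ≤ j}) ∧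
          (∑ V₀ ∈ (Finset.univ : Finset (Finset (Fin n))).filter (fun V₀ => o ∈ V₀ ∧ Disjoint V₀ A),
              (Literature.Probability.LatticeModels.prodBernoulli w).real
                ({ω : Literature.Probability.Percolation.BondConfig (Fin n) |
                    1 ≤ (A.filter fun x => ω ∈ Literature.Probability.Percolation.openConn o x).card} ∩
                  (Literature.Probability.Percolation.openConn o (c V₀))ᶜ ∩
                  {ω : Literature.Probability.Percolation.BondConfig (Fin n) |
                    (A.filter fun x => ω ∈ Literature.Probability.Percolation.openConn (c V₀) x).card ≤ j} ∩
                  {ω : Literature.Probability.Percolation.BondConfig (Fin n) |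
                    (∀ u ∈ V₀, ω ∈ Literature.Probability.Percolation.openConnIn (↑V₀ : Set (Fin n)) o u) ∧
                      ∀ u ∈ V₀, ∀ x, x ∉ V₀ → x ∉ A → s(u, x) ∉ ω}) ≤
            C₂ * (Literature.Probability.LatticeModels.prodBernoulli w).real
                {ω : Literature.Probability.Percolation.BondConfig (Fin n) |
                  (A.filter fun x => ω ∈ Literature.Probability.Percolation.openConn a x).card ≤ j})) :
    Summit.CriticalPhenomena.PercolationContinuityZ3.Theses.PercNearOneGluing.NoHeavyLowerTail := by
  refine noHeavyLowerTail_of_portSelection (C₁ + C₂) (by positivity) fun n w A o j hA hoA => ?_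
  obtain ⟨c, hc, a, ha, h₁, h₂⟩ := hSPLIT n w A o j hA hoA
  refine ⟨c, hc, a, ha, ?_⟩
  calc
    _ ≤ ∑ V₀ ∈ (Finset.univ : Finset (Finset (Fin n))).filter (fun V₀ => o ∈ V₀ ∧ Disjoint V₀ A),
          ((prodBernoulli w).real
              (openConn o (c V₀) ∩ {ω : BondConfig (Fin n) | (A.filter fun x => ω ∈ openConn o x).card ≤ j} ∩
                {ω : BondConfig (Fin n) | (∀ u ∈ V₀, ω ∈ openConnIn (↑V₀ : Set (Fin n)) o u) ∧
                  ∀ u ∈ V₀, ∀ x, x ∉ V₀ → x ∉ A → s(u, x) ∉ ω}) +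
            (prodBernoulli w).real
              ({ω : BondConfig (Fin n) | 1 ≤ (A.filter fun x => ω ∈ openConn o x).card} ∩ (openConn o (c V₀))ᶜ ∩
                {ω : BondConfig (Fin n) | (A.filter fun x => ω ∈ openConn (c V₀) x).card ≤ j} ∩
                {ω : BondConfig (Fin n) | (∀ u ∈ V₀, ω ∈ openConnIn (↑V₀ : Set (Fin n)) o u) ∧
                  ∀ u ∈ V₀, ∀ x, x ∉ V₀ → x ∉ A → s(u, x) ∉ ω})) :=
        Finset.sum_le_sum fun V₀ _ => selectionSummand_le_split (prodBernoulli w) A V₀ o (c V₀) j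
    _ = _ := Finset.sum_add_distrib
    _ ≤ C₁ * (prodBernoulli w).real {ω : BondConfig (Fin n) | (A.filter fun x => ω ∈ openConn a x).card ≤ j} +
        C₂ * (prodBernoulli w).real {ω : BondConfig (Fin n) | (A.filter fun x => ω ∈ openConn a x).card ≤ j} :=
        add_le_add h₁ h₂
    _ = (C₁ + C₂) * (prodBernoulli w).real
          {ω : BondConfig (Fin n) | (A.filter fun x => ω ∈ openConn a x).card ≤ j} := by ring

end Summit.CriticalPhenomena.PercolationContinuityZ3.Theorems
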